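import Summits.CriticalPhenomena.PercolationContinuityZ3.Theorems.PercNearOneGluingAdditiveGluingFibreContraction
import Mathlib.Combinatorics.SimpleGraph.Connectivity.Finite
import HarnessLib

/-!
# Crux `PercNearOneGluing.AdditiveGluing` (stmt-CriticalPhenomena-4576), line `tieline`:
# a computable evaluator for the fibre counts `fibreSumT`, and the u-side contraction hypothesis (CM3)-u is FALSE

Support file (`--supports stmt-CriticalPhenomena-4576`, lead-of-record prim-png-lead-4576 gen 6).  No named facts, no sorries.

`…FibreContraction` reduces the kernel (T) to contraction-monotonicity of the weight-free fibre counts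
`fibreSumT o b u v c I` at the boundary of the `3`-component of `v` (`fibreSumT_nonneg_of_contractionMonotone`) and, in a
second variant, at the boundary of the `3`-component of `u` (`fibreSumT_nonneg_of_contractionMonotone_u`).  The ttrl2 census
(run/shared/lean/ttrl/fibre/README.md, (CM3) 17:45Z, exact integer fibre counts, three independent engines) found that the
u-side hypothesis FAILS: on `Fin 6` with roles `(u, v, o, c, b) = (0, 1, 4, 2, 5)` and count vector `I` = `1` on
`s(0,3), s(2,5), s(3,4), s(3,5)`, `2` on `s(1,4), s(1,5), s(2,4)`, `0` elsewhere, contracting the random edge `s(0,3)` at `u`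
INCREASES the count: `fibreSumT 4 5 0 1 2 I = 4 < 5 = fibreSumT 4 5 0 1 2 (I[s(0,3) ↦ 3])` (all v-edges censused so far are
monotone: 0 violations on every graph with ≤ 7 vertices and ≤ 10 edges).

This file makes that kernel-checkable:
* `fibreSumTB` — a COMPUTABLE integer version of `fibreSumT` (sum over the fibre re-indexed as a product of per-edge replica
  patterns, connectivity decided by Mathlib's `SimpleGraph.Reachable` decision procedure) and `fibreSumT_eq_cast :
  fibreSumT o b u v c I = fibreSumTB o b u v c I` (for every `n`, roles and `I`; reusable to certify any single fibre count);
* `fibreSumTB_witness`, `fibreSumTB_witness_contracted` — the two evaluations `4` and `5` (`native_decide`, COMPUTATIONAL);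
* `not_contractionMonotone_u_witness` — the hypothesis `hCM` of `fibreSumT_nonneg_of_contractionMonotone_u` at
  `(n; o, b, u, v, c) = (6; 4, 5, 0, 1, 2)` is false, hence (`not_contractionMonotone_u_forall`) it is not true for all roles:
  the u-side reduction is vacuous in general and only the v-side theorem is a live route to (CNT) ⇒ (T).
Nothing here refutes (T), (CNT) or the crux (both counts are positive, as (CNT) predicts).
[folklore] (finite enumeration; re-indexing a sum along an equivalence)
-/

namespace Summit.CriticalPhenomena.PercolationContinuityZ3.Cruxes.AdditiveGluing.TieLine.FibreCount

open Finset Literature.Probability.Percolation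
open scoped BigOperators

section Eval

variable {n : ℕ}

/-- Adjacency of the open graph of a Boolean configuration is decidable (computably). [folklore] -/
instance instDecidableRelAdjCfg (a : Sym2 (Fin n) → Bool) : DecidableRel (openGraph (cfg a)).Adj := fun x y =>
  decidable_of_iff (a s(x, y) = true ∧ x ≠ y) (openGraph_adj (cfg a) x y).symm

/-- Computable reachability `x ↔ y` in the open graph of a Boolean configuration. [folklore] -/
def reachB (a : Sym2 (Fin n) → Bool) (x y : Fin n) : Bool := decide ((openGraph (cfg a)).Reachable x y)

/-- `reachB` decides the connection event. [folklore] -/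
theorem reachB_eq_true_iff (a : Sym2 (Fin n) → Bool) (x y : Fin n) :
    reachB a x y = true ↔ (openGraph (cfg a)).Reachable x y := by
  unfold reachB; exact decide_eq_true_iff

/-- Membership of a Boolean configuration in a connection event, computably. [folklore] -/
theorem cfg_mem_openConn_iff (a : Sym2 (Fin n) → Bool) (x y : Fin n) :
    cfg a ∈ (openConn x y : Set (BondConfig (Fin n))) ↔ reachB a x y = true := by
  rw [reachB_eq_true_iff]; rfl

/-- The replica patterns `(x, y, z) ∈ Bool³` of weight `k` (number of `true`s). [folklore] -/
def pat (k : ℕ) : Finset (Bool × Bool × Bool) := Finset.univ.filter fun p => cnt3 p.1 p.2.1 p.2.2 = k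

/-- A replica triple as ONE function into `Bool³` (zip). [folklore] -/
def zip3 {ι : Type*} : Triple ι ≃ (ι → Bool × Bool × Bool) where
  toFun t := fun i => (t.1 i, t.2.1 i, t.2.2 i)
  invFun g := (fun i => (g i).1, fun i => (g i).2.1, fun i => (g i).2.2)
  left_inv _ := rfl
  right_inv _ := rfl

/-- The signed summand of (T)'s fibre count for three Boolean configurations (replicas 1, 2, 3), as an integer:
`+ N₁·(D∩ub)₂·(D∩vo)₃ − N₁·D₂·(D∩ub∩vo)₃ − (N∩oc)₁·(D∩ub)₂·(D∩vc)₃ + (N∩oc)₁·D₂·(D∩ub∩vc)₃`. [folklore] -/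
def summandTB (o b u v c : Fin n) (a₁ a₂ a₃ : Sym2 (Fin n) → Bool) : ℤ :=
  let N := !(reachB a₁ c u) && !(reachB a₁ c v)
  let Noc := N && reachB a₁ o c
  let D₂ := !(reachB a₂ u v)
  let Dub := D₂ && reachB a₂ u b
  let D₃ := !(reachB a₃ u v)
  let Dvo := D₃ && reachB a₃ v o
  let Dvc := D₃ && reachB a₃ v c
  let Dubvo := (D₃ && reachB a₃ u b) && reachB a₃ v o
  let Dubvc := (D₃ && reachB a₃ u b) && reachB a₃ v c
  (if (N && Dub && Dvo) = true then 1 else 0) - (if (N && D₂ && Dubvo) = true then 1 else 0) -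
    (if (Noc && Dub && Dvc) = true then 1 else 0) + (if (Noc && D₂ && Dubvc) = true then 1 else 0)

/-- **Computable fibre count of (T).**  The integer `fibreSumT o b u v c I`, computed by enumerating the fibre of the count vector
`I` as the product over edges `e` of the replica patterns of weight `I e`. [folklore] -/
def fibreSumTB (o b u v c : Fin n) (I : Sym2 (Fin n) → ℕ) : ℤ :=
  ∑ g ∈ Fintype.piFinset (fun e => pat (I e)), summandTB o b u v c (fun e => (g e).1) (fun e => (g e).2.1) (fun e => (g e).2.2)

/-- An indicator `ind A B C t` equals the cast of a Boolean `if`, once the three memberships are decided by Booleans. [folklore] -/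
theorem ind_eq_cast_ite {ι : Type*} (A B C : Set (Set ι)) (t : Triple ι) (p q r : Bool)
    (hp : cfg t.1 ∈ A ↔ p = true) (hq : cfg t.2.1 ∈ B ↔ q = true) (hr : cfg t.2.2 ∈ C ↔ r = true) :
    ind A B C t = ((if (p && q && r) = true then (1 : ℤ) else 0 : ℤ) : ℝ) := by
  unfold ind
  cases p <;> cases q <;> cases r <;> simp [hp, hq, hr]

/-- Membership in `N = {c ↮ u} ∩ {c ↮ v}`, computably. [folklore] -/
theorem cfg_mem_N_iff (a : Sym2 (Fin n) → Bool) (c u v : Fin n) :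
    cfg a ∈ ((openConn c u)ᶜ ∩ (openConn c v)ᶜ : Set (BondConfig (Fin n))) ↔
      (!(reachB a c u) && !(reachB a c v)) = true := by
  simp only [Set.mem_inter_iff, Set.mem_compl_iff, cfg_mem_openConn_iff, Bool.and_eq_true, Bool.not_eq_true',
    Bool.not_eq_true]

/-- Membership in `N ∩ {o ↔ c}`, computably. [folklore] -/
theorem cfg_mem_Noc_iff (a : Sym2 (Fin n) → Bool) (o c u v : Fin n) :
    cfg a ∈ ((openConn c u)ᶜ ∩ (openConn c v)ᶜ ∩ openConn o c : Set (BondConfig (Fin n))) ↔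
      ((!(reachB a c u) && !(reachB a c v)) && reachB a o c) = true := by
  simp only [Set.mem_inter_iff, Set.mem_compl_iff, cfg_mem_openConn_iff, Bool.and_eq_true, Bool.not_eq_true',
    Bool.not_eq_true]

/-- Membership in `D = {u ↮ v}`, computably. [folklore] -/
theorem cfg_mem_D_iff (a : Sym2 (Fin n) → Bool) (u v : Fin n) :
    cfg a ∈ ((openConn u v)ᶜ : Set (BondConfig (Fin n))) ↔ (!(reachB a u v)) = true := by
  simp only [Set.mem_compl_iff, cfg_mem_openConn_iff, Bool.not_eq_true', Bool.not_eq_true]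

/-- Membership in `D ∩ {x ↔ y}`, computably. [folklore] -/
theorem cfg_mem_D_inter_iff (a : Sym2 (Fin n) → Bool) (u v x y : Fin n) :
    cfg a ∈ ((openConn u v)ᶜ ∩ openConn x y : Set (BondConfig (Fin n))) ↔ (!(reachB a u v) && reachB a x y) = true := by
  simp only [Set.mem_inter_iff, Set.mem_compl_iff, cfg_mem_openConn_iff, Bool.and_eq_true, Bool.not_eq_true',
    Bool.not_eq_true]

/-- Membership in `D ∩ {x ↔ y} ∩ {x' ↔ y'}`, computably. [folklore] -/
theorem cfg_mem_D_inter_inter_iff (a : Sym2 (Fin n) → Bool) (u v x y x' y' : Fin n) :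
    cfg a ∈ ((openConn u v)ᶜ ∩ openConn x y ∩ openConn x' y' : Set (BondConfig (Fin n))) ↔
      ((!(reachB a u v) && reachB a x y) && reachB a x' y') = true := by
  simp only [Set.mem_inter_iff, Set.mem_compl_iff, cfg_mem_openConn_iff, Bool.and_eq_true, Bool.not_eq_true',
    Bool.not_eq_true]

/-- A triple has count vector `I` iff its zip lies in the product of the pattern sets `pat (I e)`. [folklore] -/
theorem mem_filter_cnt_iff_zip3_mem (I : Sym2 (Fin n) → ℕ) {inst : Fintype (Triple (Sym2 (Fin n)))}
    {dec : DecidablePred fun t : Triple (Sym2 (Fin n)) => cnt t = I} (t : Triple (Sym2 (Fin n))) :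
    t ∈ @Finset.filter _ (fun t => cnt t = I) dec (@Finset.univ _ inst) ↔
      zip3 t ∈ Fintype.piFinset (fun e => pat (I e)) := by
  simp only [Finset.mem_filter, Finset.mem_univ, true_and, Fintype.mem_piFinset, pat]
  constructor
  · intro h e
    rw [← h]
    rfl
  · intro h
    funext e
    exact h e

/-- **Evaluation theorem.**  The real fibre count `fibreSumT` is the cast of the computable integer `fibreSumTB`
(for every vertex count, every role tuple and every count vector). [folklore] -/
theorem fibreSumT_eq_cast (o b u v c : Fin n) (I : Sym2 (Fin n) → ℕ) :
    fibreSumT o b u v c I = (fibreSumTB o b u v c I : ℝ) := by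
  unfold fibreSumT fibreSum4 fibreSumTB
  rw [Int.cast_sum]
  refine Finset.sum_equiv zip3 (fun t => mem_filter_cnt_iff_zip3_mem I t) (fun t _ => ?_)
  rw [ind_eq_cast_ite _ _ _ t _ _ _ (cfg_mem_N_iff t.1 c u v) (cfg_mem_D_inter_iff t.2.1 u v u b)
      (cfg_mem_D_inter_iff t.2.2 u v v o),
    ind_eq_cast_ite _ _ _ t _ _ _ (cfg_mem_N_iff t.1 c u v) (cfg_mem_D_iff t.2.1 u v)
      (cfg_mem_D_inter_inter_iff t.2.2 u v u b v o),
    ind_eq_cast_ite _ _ _ t _ _ _ (cfg_mem_Noc_iff t.1 o c u v) (cfg_mem_D_inter_iff t.2.1 u v u b)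
      (cfg_mem_D_inter_iff t.2.2 u v v c),
    ind_eq_cast_ite _ _ _ t _ _ _ (cfg_mem_Noc_iff t.1 o c u v) (cfg_mem_D_iff t.2.1 u v)
      (cfg_mem_D_inter_inter_iff t.2.2 u v u b v c)]
  show _ = ((summandTB o b u v c t.1 t.2.1 t.2.2 : ℤ) : ℝ)
  unfold summandTB
  push_cast
  ring

end Eval

/-! ### The ttrl2 witness against the u-side hypothesis -/

section Witness

/-- The count vector of the ttrl2 witness on `Fin 6`: `1` on `s(0,3), s(2,5), s(3,4), s(3,5)`, `2` on `s(1,4), s(1,5), s(2,4)`,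
`0` elsewhere (roles `(u, v, o, c, b) = (0, 1, 4, 2, 5)`). [folklore] -/
def witnessI : Sym2 (Fin 6) → ℕ := fun e =>
  if e = s(0, 3) ∨ e = s(2, 5) ∨ e = s(3, 4) ∨ e = s(3, 5) then 1
  else if e = s(1, 4) ∨ e = s(1, 5) ∨ e = s(2, 4) then 2 else 0

/-- Every value of the witness count vector is at most `2` (no contracted edges). [folklore] -/
theorem witnessI_le_two (e : Sym2 (Fin 6)) : witnessI e ≤ 2 := by
  unfold witnessI
  split_ifs <;> omega

/-- Hence its `3`-set is empty. [folklore] -/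
theorem witnessI_threeSet_eq_empty : {e : Sym2 (Fin 6) | witnessI e = 3} = (∅ : Set (Sym2 (Fin 6))) := by
  ext e
  simp only [Set.mem_setOf_eq, Set.mem_empty_iff_false, iff_false]
  have := witnessI_le_two e
  omega

/-- In the witness, nothing is `3`-reachable from anything else. [folklore] -/
theorem witnessI_reachable_iff (x y : Fin 6) : (openGraph {e : Sym2 (Fin 6) | witnessI e = 3}).Reachable x y ↔ x = y := by
  rw [witnessI_threeSet_eq_empty]
  show (SimpleGraph.fromEdgeSet (∅ : Set (Sym2 (Fin 6)))).Reachable x y ↔ x = y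
  rw [SimpleGraph.fromEdgeSet_empty, SimpleGraph.reachable_bot]

/-- The witness edge `s(0,3)` is a solo edge. [folklore] -/
theorem witnessI_edge : witnessI s(0, 3) = 1 := by
  unfold witnessI
  simp

/-- `fibreSumT 4 5 0 1 2 witnessI = 4` (COMPUTATIONAL, `native_decide`). [folklore] -/
theorem fibreSumTB_witness : fibreSumTB (4 : Fin 6) 5 0 1 2 witnessI = 4 := by
  native_decide

/-- After contracting `s(0,3)` the count is `5` (COMPUTATIONAL, `native_decide`). [folklore] -/
theorem fibreSumTB_witness_contracted : fibreSumTB (4 : Fin 6) 5 0 1 2 (Function.update witnessI s(0, 3) 3) = 5 := by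
  native_decide

/-- **(CM3) at u-edges is false.**  The hypothesis `hCM` of `fibreSumT_nonneg_of_contractionMonotone_u` fails at
`n = 6`, `(o, b, u, v, c) = (4, 5, 0, 1, 2)`: contracting the solo edge `s(u, 3) = s(0, 3)` (with `3` outside the `3`-components
of `u` and `v`) raises the fibre count from `4` to `5` (ttrl2 census, fibre/README.md (CM3); here kernel-checked). [folklore] -/
theorem not_contractionMonotone_u_witness :
    ¬ (∀ I : Sym2 (Fin 6) → ℕ, ∀ x z : Fin 6, (openGraph {e | I e = 3}).Reachable (0 : Fin 6) x →
      ¬ (openGraph {e | I e = 3}).Reachable (0 : Fin 6) z → ¬ (openGraph {e | I e = 3}).Reachable (1 : Fin 6) z →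
      (I s(x, z) = 1 ∨ I s(x, z) = 2) →
      fibreSumT (4 : Fin 6) 5 0 1 2 (Function.update I s(x, z) 3) ≤ fibreSumT (4 : Fin 6) 5 0 1 2 I) := by
  intro h
  have h03 : ¬ (openGraph {e : Sym2 (Fin 6) | witnessI e = 3}).Reachable (0 : Fin 6) 3 := by
    rw [witnessI_reachable_iff]; decide
  have h13 : ¬ (openGraph {e : Sym2 (Fin 6) | witnessI e = 3}).Reachable (1 : Fin 6) 3 := by
    rw [witnessI_reachable_iff]; decide
  have key := h witnessI 0 3 (SimpleGraph.Reachable.refl _) h03 h13 (Or.inl witnessI_edge)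
  rw [fibreSumT_eq_cast, fibreSumT_eq_cast, fibreSumTB_witness, fibreSumTB_witness_contracted] at key
  norm_num at key

/-- **Corollary.**  The u-side contraction hypothesis is not available for all role tuples: the reduction
`covTransferQ_of_contractionMonotone_u` cannot be fed in general (the v-side `covTransferQ_of_contractionMonotone` is the live
route; its hypothesis has no known violation). [folklore] -/
theorem not_contractionMonotone_u_forall :
    ¬ (∀ (n : ℕ) (o b u v c : Fin n), ∀ I : Sym2 (Fin n) → ℕ, ∀ x z : Fin n, (openGraph {e | I e = 3}).Reachable u x →
      ¬ (openGraph {e | I e = 3}).Reachable u z → ¬ (openGraph {e | I e = 3}).Reachable v z →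
      (I s(x, z) = 1 ∨ I s(x, z) = 2) →
      fibreSumT o b u v c (Function.update I s(x, z) 3) ≤ fibreSumT o b u v c I) :=
  fun h => not_contractionMonotone_u_witness (h 6 4 5 0 1 2)

end Witness

end Summit.CriticalPhenomena.PercolationContinuityZ3.Cruxes.AdditiveGluing.TieLine.FibreCount
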